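import Summits.QuantumFields.YangMills.Theorems.LuscherReductionRunningReductionTraceFormulaDefs
import Summits.QuantumFields.YangMills.Theorems.FemtoTransferGapPhysL2
import Summits.QuantumFields.YangMills.Theorems.LuscherReductionOneSiteLevelsPhysClass
import HarnessLib

/-!
# Crux RED `RunningReduction`, line «KTR» rev 6, towards `TT.stub_traceFormula` (1/3): the physical average `P` —
# composite centre twists, measurability, `P f` is physical, `P ψ = ψ` and `∫ (P f) ψ = ∫ f ψ` for physical `ψ`

Fleet-service module of seat ym-infvol-p1 g3 (route `LuscherReduction`, crux RED `stmt-QuantumFields-19978`; route owner ym-beyond-p1 g18 PROGRESS 3,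
ask (δ) «an idle M-seat on the TT door takes `stub_traceFormula`», ym-beyond bus 2026-08-27T06:21:40Z).  First of three modules proving the body of
`TT.TraceFormula` over the re-homed objects of `Theorems/LuscherReductionRunningReductionTraceFormulaDefs.lean` (p507042):
`physAvg f U = (1/8) Σ_{z ∈ (ℤ/2)³} ∫ f(g · tw_z U) dg`.  This file is the elementary layer about the averaging `P = physAvg`:

* §1 the composite centre twist `twist3 z` (one bit per spatial direction): the link formula `twist3_apply`, the group law `twist3_twist3`
  (bits add), involutivity, commutation with gauge transformations (central factors), and — since the centre of `SU(2)` is `{±1}`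
  (tree `coe_eq_one_or_neg_one_of_mem_center`) — every single central twist `twist k z₀` is a composite twist (`twist_centreElem_eq_twist3`);
* §2 measurability and measure preservation of `U ↦ g · tw_z U` (tree `measurePreserving_gaugeTransform_configMeasure`, `measurePreserving_twist`),
  joint measurability in `(g, U)`, and the probability ∕ right-invariance ∕ inversion-invariance of the gauge Haar measure `gaugeMeasure L`
  (compact groups are unimodular: Literature `haarProbability.instIsMulRightInvariant ∕ instIsInvInvariant`, Mathlib `Measure.pi.*`);
* §3 `|P f| ≤ C`, `P f` measurable, **`isPhys_physAvg`** (`P f` is an exactly gauge- and twist-invariant bounded measurable function: right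
  invariance of Haar measure; reindexing the eight twists), **`physAvg_eq_self_of_isPhys`** (`P ψ = ψ`), and **`integral_physAvg_mul_of_isPhys`**
  (`∫ (P f) ψ dμ = ∫ f ψ dμ` for physical `ψ`: Fubini, invariance of the a-priori measure under `g · tw_z`, invariance of `ψ`).

HONEST FRAMING: fixed-lattice measure theory for the femto rung R2b1 (Reed–Simon VI.22–23 bookkeeping); no renormalisation-group content; nothing here
bears on infinite volume, the continuum limit or the Clay gap.
References: [cite: Luscher1983, §2]; [cite: tHooft1979]; [cite: SeilerLNP1982, §3]; [cite: BrockerTomDieck1985, I (1.10)].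
-/

set_option autoImplicit false

noncomputable section

open MeasureTheory Filter Topology Real
open Literature.MathematicalPhysics.QuantumFieldTheory
open Literature.MathematicalPhysics.QuantumLattice
open Literature.Analysis.OperatorTheory.YMMatrixModel
open Literature.Analysis.OperatorTheory
open scoped InnerProductSpace BigOperators

namespace Summit.QuantumFields.YangMills.Theorems.FemtoTransferGap.TT

open Summit.QuantumFields.YangMills.Theorems.FemtoTransferGap
open Summit.QuantumFields.YangMills.Theorems.FemtoTransferGap.PhysL2

/-! ## §1 Centre elements and the composite twist -/

/-- `centreElem b` is central. [folklore] -/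
theorem centreElem_mem_center (b : Bool) : centreElem b ∈ Subgroup.center SU2 := by
  cases b
  · exact Subgroup.one_mem _
  · exact negOne_mem_center

/-- `centreElem a * centreElem b = centreElem (a xor b)`. [folklore] -/
theorem centreElem_mul (a b : Bool) : centreElem a * centreElem b = centreElem (Bool.xor a b) := by
  cases a <;> cases b <;> simp [centreElem]

/-- The composite twist link by link: the link `e = (x, i)` is multiplied by `centreElem (z i)` iff `x_i = 0`. [folklore] -/
theorem twist3_apply {L : ℕ} (z : Fin 3 → Bool) (U : GaugeConfig 3 L SU2) (e : Edge 3 L) :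
    twist3 z U e = (if e.1 e.2 = 0 then centreElem (z e.2) else 1) * U e := by
  obtain ⟨x, i⟩ := e
  simp only [twist3, twist_apply_eq_ite_mul]
  fin_cases i <;> simp

/-- Composite twists compose by adding the bits. [folklore] -/
theorem twist3_twist3 {L : ℕ} (z w : Fin 3 → Bool) (U : GaugeConfig 3 L SU2) :
    twist3 z (twist3 w U) = twist3 (fun k => Bool.xor (z k) (w k)) U := by
  funext e
  rw [twist3_apply, twist3_apply, twist3_apply, ← mul_assoc]
  congr 1
  split_ifs <;> simp [centreElem_mul]

/-- The trivial composite twist. [folklore] -/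
@[simp] theorem twist3_false {L : ℕ} (U : GaugeConfig 3 L SU2) : twist3 (fun _ => false) U = U := by
  funext e
  rw [twist3_apply]
  simp [centreElem]

/-- The composite twist is an involution. [folklore] -/
theorem twist3_twist3_self {L : ℕ} (z : Fin 3 → Bool) (U : GaugeConfig 3 L SU2) : twist3 z (twist3 z U) = U := by
  rw [twist3_twist3]
  convert twist3_false U using 2
  simp

/-- Gauge transformations commute with composite twists (the twist factors are central). [folklore] -/
theorem gaugeTransform_twist3 {L : ℕ} (g : Site 3 L → SU2) (z : Fin 3 → Bool) (U : GaugeConfig 3 L SU2) :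
    gaugeTransform g (twist3 z U) = twist3 z (gaugeTransform g U) := by
  funext e
  simp only [gaugeTransform, twist3_apply]
  set c : SU2 := if e.1 e.2 = 0 then centreElem (z e.2) else 1 with hc
  have hcc : c ∈ Subgroup.center SU2 := by
    rw [hc]; split_ifs
    · exact centreElem_mem_center _
    · exact Subgroup.one_mem _
  have hcomm := Subgroup.mem_center_iff.mp hcc
  rw [← mul_assoc (g e.1) c (U e), hcomm (g e.1)]
  simp only [mul_assoc]

/-- Gauge transformations compose. [folklore] -/
theorem gaugeTransform_gaugeTransform {L : ℕ} (g h : Site 3 L → SU2) (U : GaugeConfig 3 L SU2) :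
    gaugeTransform g (gaugeTransform h U) = gaugeTransform (g * h) U := by
  funext e; simp only [gaugeTransform, Pi.mul_apply, mul_inv_rev]; group

/-- A central element of `SU(2)` is `centreElem b` for some bit `b`. [folklore] -/
theorem exists_eq_centreElem_of_mem_center {z₀ : SU2} (hz : z₀ ∈ Subgroup.center SU2) : ∃ b : Bool, z₀ = centreElem b := by
  rcases coe_eq_one_or_neg_one_of_mem_center hz with h | h
  · refine ⟨false, Subtype.ext ?_⟩
    rw [h]; simp [centreElem]
  · refine ⟨true, Subtype.ext ?_⟩
    rw [h]; simp [centreElem]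

/-- A single central twist is a composite twist. [folklore] -/
theorem twist_centreElem_eq_twist3 {L : ℕ} (k : Fin 3) (b : Bool) (U : GaugeConfig 3 L SU2) :
    twist k (centreElem b) U = twist3 (fun j => decide (j = k) && b) U := by
  funext e
  rw [twist_apply_eq_ite_mul, twist3_apply]
  congr 1
  by_cases h2 : e.2 = k
  · subst h2
    simp
  · have : (decide (e.2 = k) && b) = false := by simp [h2]
    rw [this]
    simp [h2, centreElem]

/-! ## §2 Measurability, measure preservation -/

variable {L : ℕ} [NeZero L]

/-- The gauge measure is a probability measure. [folklore] -/
theorem isProbabilityMeasure_gaugeMeasure : IsProbabilityMeasure (gaugeMeasure L) := by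
  unfold gaugeMeasure; infer_instance

/-- Right invariance of the gauge measure (product of Haar probabilities on a compact group: compact groups are unimodular). [folklore] -/
theorem isMulRightInvariant_gaugeMeasure : (gaugeMeasure L).IsMulRightInvariant := by
  haveI : SecondCountableTopology SU2 := secondCountableTopology_su2
  unfold gaugeMeasure; infer_instance

/-- Inversion invariance of the gauge measure (product of inversion-invariant Haar probabilities). [folklore] -/
theorem isInvInvariant_gaugeMeasure : (gaugeMeasure L).IsInvInvariant := by
  haveI : SecondCountableTopology SU2 := secondCountableTopology_su2
  unfold gaugeMeasure; infer_instance

/-- The composite twist is measurable. [folklore] -/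
theorem measurable_twist3 (z : Fin 3 → Bool) : Measurable (twist3 (L := L) z) :=
  (measurePreserving_twist (G := SU2) (L := L) 0 _).measurable.comp
    ((measurePreserving_twist (G := SU2) (L := L) 1 _).measurable.comp (measurePreserving_twist (G := SU2) (L := L) 2 _).measurable)

/-- The composite twist preserves the a-priori measure. [folklore] -/
theorem measurePreserving_twist3 (z : Fin 3 → Bool) :
    MeasurePreserving (twist3 (L := L) z) (configMeasure SU2 L) (configMeasure SU2 L) :=
  (measurePreserving_twist (G := SU2) (L := L) 0 _).comp
    ((measurePreserving_twist (G := SU2) (L := L) 1 _).comp (measurePreserving_twist (G := SU2) (L := L) 2 _))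

/-- The combined action `U ↦ g · tw_z U` preserves the a-priori measure. [folklore] -/
theorem measurePreserving_act (g : Site 3 L → SU2) (z : Fin 3 → Bool) :
    MeasurePreserving (fun U : GaugeConfig 3 L SU2 => gaugeTransform g (twist3 z U)) (configMeasure SU2 L) (configMeasure SU2 L) :=
  (measurePreserving_gaugeTransform_configMeasure g).comp (measurePreserving_twist3 z)

omit [NeZero L] in
/-- Joint measurability of `(g, U) ↦ g · U` (link by link a product of measurable coordinate maps). [folklore] -/
theorem measurable_gaugeTransform_uncurry :
    Measurable fun p : (Site 3 L → SU2) × GaugeConfig 3 L SU2 => gaugeTransform p.1 p.2 := by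
  haveI : SecondCountableTopology SU2 := secondCountableTopology_su2
  refine measurable_pi_iff.mpr fun e => ?_
  simp only [gaugeTransform]
  exact (((measurable_pi_apply e.1).comp measurable_fst).mul ((measurable_pi_apply e).comp measurable_snd)).mul
    ((measurable_pi_apply (e.1.shift e.2)).comp measurable_fst).inv

/-- Joint measurability of `(g, U) ↦ g · tw_z U`. [folklore] -/
theorem measurable_act_uncurry (z : Fin 3 → Bool) :
    Measurable (fun p : (Site 3 L → SU2) × GaugeConfig 3 L SU2 => gaugeTransform p.1 (twist3 z p.2)) := by
  have h1 : Measurable fun p : (Site 3 L → SU2) × GaugeConfig 3 L SU2 => (p.1, twist3 z p.2) :=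
    measurable_fst.prodMk ((measurable_twist3 z).comp measurable_snd)
  have h2 := (measurable_gaugeTransform_uncurry (L := L)).comp h1
  exact h2




/-! ## §3 The physical average: boundedness, measurability, values, invariance -/

omit [NeZero L] in
/-- `gaugeTransform 1 = id`. [folklore] -/
@[simp] theorem gaugeTransform_one' (U : GaugeConfig 3 L SU2) : gaugeTransform (1 : Site 3 L → SU2) U = U := by
  funext e; simp [gaugeTransform]

omit [NeZero L] in
/-- Undoing a gauge transformation. [folklore] -/
theorem gaugeTransform_inv_gaugeTransform (g : Site 3 L → SU2) (U : GaugeConfig 3 L SU2) :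
    gaugeTransform g⁻¹ (gaugeTransform g U) = U := by
  rw [gaugeTransform_gaugeTransform, inv_mul_cancel, gaugeTransform_one']

omit [NeZero L] in
/-- And the other way round. [folklore] -/
theorem gaugeTransform_gaugeTransform_inv (g : Site 3 L → SU2) (U : GaugeConfig 3 L SU2) :
    gaugeTransform g (gaugeTransform g⁻¹ U) = U := by
  rw [gaugeTransform_gaugeTransform, mul_inv_cancel, gaugeTransform_one']

/-- The transfer kernel is invariant under a simultaneous composite twist. [cite: tHooft1979] -/
theorem transferKernel_twist3 (β : ℝ) (z : Fin 3 → Bool) (U V : GaugeConfig 3 L SU2) :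
    transferKernel su2Rep β (twist3 z U) (twist3 z V) = transferKernel su2Rep β U V := by
  simp only [twist3]
  rw [transferKernel_twist su2Rep β 0 (centreElem_mem_center _), transferKernel_twist su2Rep β 1 (centreElem_mem_center _),
    transferKernel_twist su2Rep β 2 (centreElem_mem_center _)]

/-- The transfer kernel is invariant under the combined action `g · tw_z`. [cite: SeilerLNP1982, §3] -/
theorem transferKernel_act (β : ℝ) (g : Site 3 L → SU2) (z : Fin 3 → Bool) (U V : GaugeConfig 3 L SU2) :
    transferKernel su2Rep β (gaugeTransform g (twist3 z U)) (gaugeTransform g (twist3 z V)) = transferKernel su2Rep β U V := by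
  rw [transferKernel_gaugeTransform, transferKernel_twist3]

/-- Moving the action from one slot of the kernel to the other: `K(g · tw_z U, V) = K(U, g⁻¹ · tw_z V)`. [cite: SeilerLNP1982, §3] -/
theorem transferKernel_act_left (β : ℝ) (g : Site 3 L → SU2) (z : Fin 3 → Bool) (U V : GaugeConfig 3 L SU2) :
    transferKernel su2Rep β (gaugeTransform g (twist3 z U)) V = transferKernel su2Rep β U (gaugeTransform g⁻¹ (twist3 z V)) := by
  conv_lhs => rw [← gaugeTransform_gaugeTransform_inv g V, ← twist3_twist3_self z (gaugeTransform g⁻¹ V)]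
  rw [transferKernel_act, gaugeTransform_twist3]

omit [NeZero L] in
/-- A physical test function is invariant under the composite twist. [folklore] -/
theorem twist3_eq_of_isPhys {ψ : GaugeConfig 3 L SU2 → ℝ} (hψ : IsPhys ψ) (z : Fin 3 → Bool) (U : GaugeConfig 3 L SU2) :
    ψ (twist3 z U) = ψ U := by
  simp only [twist3]
  rw [hψ.zeroFlux 0 _ (centreElem_mem_center _), hψ.zeroFlux 1 _ (centreElem_mem_center _), hψ.zeroFlux 2 _ (centreElem_mem_center _)]

omit [NeZero L] in
/-- A physical test function is invariant under the combined action. [folklore] -/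
theorem act_eq_of_isPhys {ψ : GaugeConfig 3 L SU2 → ℝ} (hψ : IsPhys ψ) (g : Site 3 L → SU2) (z : Fin 3 → Bool)
    (U : GaugeConfig 3 L SU2) : ψ (gaugeTransform g (twist3 z U)) = ψ U := by
  rw [hψ.gaugeInv, twist3_eq_of_isPhys hψ]

/-- The number of composite twists is `8`. [folklore] -/
theorem card_twists : Fintype.card (Fin 3 → Bool) = 8 := by simp

/-- **Bound**: `|P f| ≤ C` if `|f| ≤ C`. [folklore] -/
theorem abs_physAvg_le {f : GaugeConfig 3 L SU2 → ℝ} {C : ℝ} (hf : ∀ U, |f U| ≤ C) (U : GaugeConfig 3 L SU2) :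
    |physAvg f U| ≤ C := by
  haveI := isProbabilityMeasure_gaugeMeasure (L := L)
  have hC0 : 0 ≤ C := (abs_nonneg _).trans (hf U)
  have h1 : ∀ z : Fin 3 → Bool, |∫ g, f (gaugeTransform g (twist3 z U)) ∂gaugeMeasure L| ≤ C := fun z => by
    have h := norm_integral_le_of_norm_le_const (μ := gaugeMeasure L) (f := fun g => f (gaugeTransform g (twist3 z U)))
      (C := C) (ae_of_all _ fun g => by rw [Real.norm_eq_abs]; exact hf _)
    rwa [probReal_univ, mul_one, Real.norm_eq_abs] at h
  unfold physAvg
  rw [abs_mul, abs_of_pos (by norm_num : (0 : ℝ) < 1 / 8)]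
  have h2 : |∑ z : Fin 3 → Bool, ∫ g, f (gaugeTransform g (twist3 z U)) ∂gaugeMeasure L| ≤ 8 * C :=
    calc |∑ z : Fin 3 → Bool, ∫ g, f (gaugeTransform g (twist3 z U)) ∂gaugeMeasure L|
        ≤ ∑ z : Fin 3 → Bool, |∫ g, f (gaugeTransform g (twist3 z U)) ∂gaugeMeasure L| := Finset.abs_sum_le_sum_abs _ _
      _ ≤ ∑ _z : Fin 3 → Bool, C := Finset.sum_le_sum fun z _ => h1 z
      _ = 8 * C := by simp
  linarith

/-- Joint measurability of `(U, g) ↦ f (g · tw_z U)`. [folklore] -/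
theorem stronglyMeasurable_act_swap {f : GaugeConfig 3 L SU2 → ℝ} (hf : Measurable f) (z : Fin 3 → Bool) :
    StronglyMeasurable (Function.uncurry fun (U : GaugeConfig 3 L SU2) (g : Site 3 L → SU2) => f (gaugeTransform g (twist3 z U))) := by
  have h1 := (measurable_act_uncurry (L := L) z).comp measurable_swap
  have h2 := hf.comp h1
  exact h2.stronglyMeasurable

/-- **Measurability** of `P f`. [folklore] -/
theorem measurable_physAvg {f : GaugeConfig 3 L SU2 → ℝ} (hf : Measurable f) : Measurable (physAvg (L := L) f) := by
  haveI := isProbabilityMeasure_gaugeMeasure (L := L)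
  unfold physAvg
  refine Measurable.const_mul (Finset.measurable_sum _ fun z _ => ?_) _
  exact (StronglyMeasurable.integral_prod_right (ν := gaugeMeasure L) (stronglyMeasurable_act_swap hf z)).measurable

/-- **`P f` is a physical zero-flux test function** for every bounded measurable `f`. [cite: Luscher1983, §2] -/
theorem isPhys_physAvg {f : GaugeConfig 3 L SU2 → ℝ} (hf : Measurable f) {C : ℝ} (hC : ∀ U, |f U| ≤ C) :
    IsPhys (physAvg (L := L) f) where
  measurable := measurable_physAvg hf
  bounded := ⟨C, abs_physAvg_le hC⟩
  gaugeInv h U := by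
    haveI := isMulRightInvariant_gaugeMeasure (L := L)
    unfold physAvg
    refine congrArg (fun x : ℝ => (1 / 8 : ℝ) * x) (Finset.sum_congr rfl fun z _ => ?_)
    have h1 : ∀ g : Site 3 L → SU2, f (gaugeTransform g (twist3 z (gaugeTransform h U))) = f (gaugeTransform (g * h) (twist3 z U)) :=
      fun g => by rw [← gaugeTransform_twist3 h, gaugeTransform_gaugeTransform]
    simp_rw [h1]
    have h2 := integral_mul_right_eq_self (μ := gaugeMeasure L) (fun g => f (gaugeTransform g (twist3 z U))) h
    exact h2
  zeroFlux k z₀ hz₀ U := by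
    obtain ⟨b, rfl⟩ := exists_eq_centreElem_of_mem_center hz₀
    unfold physAvg
    refine congrArg (fun x : ℝ => (1 / 8 : ℝ) * x) ?_
    rw [twist_centreElem_eq_twist3]
    set w : Fin 3 → Bool := fun j => decide (j = k) && b with hw
    simp_rw [twist3_twist3]
    have hinv : Function.Involutive fun z : Fin 3 → Bool => fun j => Bool.xor (z j) (w j) := fun z => by
      funext j; simp
    exact Equiv.sum_comp hinv.toPerm (fun z : Fin 3 → Bool => ∫ g, f (gaugeTransform g (twist3 z U)) ∂gaugeMeasure L)

/-- **`P ψ = ψ` for physical `ψ`** (every integrand is constant). [cite: Luscher1983, §2] -/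
theorem physAvg_eq_self_of_isPhys {ψ : GaugeConfig 3 L SU2 → ℝ} (hψ : IsPhys ψ) : physAvg (L := L) ψ = ψ := by
  haveI := isProbabilityMeasure_gaugeMeasure (L := L)
  funext U
  unfold physAvg
  simp_rw [act_eq_of_isPhys hψ, integral_const, probReal_univ, one_smul, Finset.sum_const, Finset.card_univ, card_twists]
  ring

/-- `P (P f) = P f`. [folklore] -/
theorem physAvg_physAvg {f : GaugeConfig 3 L SU2 → ℝ} (hf : Measurable f) {C : ℝ} (hC : ∀ U, |f U| ≤ C) :
    physAvg (L := L) (physAvg f) = physAvg f :=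
  physAvg_eq_self_of_isPhys (isPhys_physAvg hf hC)

/-- **`∫ (P f) ψ = ∫ f ψ` for physical `ψ`** (Fubini, invariance of the a-priori measure under `g · tw_z`, invariance of `ψ`).
[cite: Luscher1983, §2] -/
theorem integral_physAvg_mul_of_isPhys {f : GaugeConfig 3 L SU2 → ℝ} (hf : Measurable f) {C : ℝ} (hC : ∀ U, |f U| ≤ C)
    {ψ : GaugeConfig 3 L SU2 → ℝ} (hψ : IsPhys ψ) :
    ∫ U, physAvg f U * ψ U ∂configMeasure SU2 L = ∫ U, f U * ψ U ∂configMeasure SU2 L := by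
  haveI := isProbabilityMeasure_gaugeMeasure (L := L)
  obtain ⟨D, hD⟩ := hψ.bounded
  have hC0 : 0 ≤ C := (abs_nonneg _).trans (hC (fun _ => 1))
  have hD0 : 0 ≤ D := (abs_nonneg _).trans (hD (fun _ => 1))
  -- each twisted-averaged term integrates against `ψ` to `∫ f ψ`
  have hterm : ∀ z : Fin 3 → Bool,
      ∫ U, (∫ g, f (gaugeTransform g (twist3 z U)) ∂gaugeMeasure L) * ψ U ∂configMeasure SU2 L =
        ∫ U, f U * ψ U ∂configMeasure SU2 L := by
    intro z
    have hF : StronglyMeasurable (Function.uncurry fun (U : GaugeConfig 3 L SU2) (g : Site 3 L → SU2) =>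
        f (gaugeTransform g (twist3 z U)) * ψ U) :=
      (stronglyMeasurable_act_swap hf z).mul ((hψ.measurable.comp measurable_fst).stronglyMeasurable)
    have hint : Integrable (Function.uncurry fun (U : GaugeConfig 3 L SU2) (g : Site 3 L → SU2) =>
        f (gaugeTransform g (twist3 z U)) * ψ U) ((configMeasure SU2 L).prod (gaugeMeasure L)) := by
      refine Integrable.of_bound hF.aestronglyMeasurable (C * D) (ae_of_all _ fun p => ?_)
      rw [Function.uncurry_apply_pair, norm_mul, Real.norm_eq_abs, Real.norm_eq_abs]
      exact mul_le_mul (hC _) (hD _) (abs_nonneg _) hC0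
    calc ∫ U, (∫ g, f (gaugeTransform g (twist3 z U)) ∂gaugeMeasure L) * ψ U ∂configMeasure SU2 L
        = ∫ U, ∫ g, f (gaugeTransform g (twist3 z U)) * ψ U ∂gaugeMeasure L ∂configMeasure SU2 L := by
          simp_rw [integral_mul_const]
      _ = ∫ g, ∫ U, f (gaugeTransform g (twist3 z U)) * ψ U ∂configMeasure SU2 L ∂gaugeMeasure L := integral_integral_swap hint
      _ = ∫ g, ∫ U, f U * ψ U ∂configMeasure SU2 L ∂gaugeMeasure L := by
          refine integral_congr_ae (ae_of_all _ fun g => ?_)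
          have hm : Measurable fun W : GaugeConfig 3 L SU2 => f W * ψ W := hf.mul hψ.measurable
          rw [← integral_comp_eq_of_measurePreserving (measurePreserving_act g z) hm]
          refine integral_congr_ae (ae_of_all _ fun U => ?_)
          simp only [act_eq_of_isPhys hψ]
      _ = ∫ U, f U * ψ U ∂configMeasure SU2 L := by
          rw [integral_const, probReal_univ, one_smul]
  -- sum the eight terms
  have hsum_int : ∀ U : GaugeConfig 3 L SU2, physAvg f U * ψ U =
      (1 / 8 : ℝ) * ∑ z : Fin 3 → Bool, (∫ g, f (gaugeTransform g (twist3 z U)) ∂gaugeMeasure L) * ψ U := fun U => by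
    unfold physAvg; rw [mul_assoc, Finset.sum_mul]
  simp_rw [hsum_int]
  rw [integral_const_mul, integral_finsetSum _ fun z _ => ?_]
  · simp_rw [hterm, Finset.sum_const, Finset.card_univ, card_twists]
    ring
  · -- integrability of each term
    have hm : Measurable fun U : GaugeConfig 3 L SU2 => (∫ g, f (gaugeTransform g (twist3 z U)) ∂gaugeMeasure L) * ψ U :=
      (StronglyMeasurable.integral_prod_right (ν := gaugeMeasure L) (stronglyMeasurable_act_swap hf z)).measurable.mul hψ.measurable
    refine Integrable.of_bound hm.aestronglyMeasurable (C * D) (ae_of_all _ fun U => ?_)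
    rw [norm_mul, Real.norm_eq_abs, Real.norm_eq_abs]
    refine mul_le_mul ?_ (hD _) (abs_nonneg _) hC0
    have h := norm_integral_le_of_norm_le_const (μ := gaugeMeasure L) (f := fun g => f (gaugeTransform g (twist3 z U)))
      (C := C) (ae_of_all _ fun g => by rw [Real.norm_eq_abs]; exact hC _)
    rwa [probReal_univ, mul_one, Real.norm_eq_abs] at h


end Summit.QuantumFields.YangMills.Theorems.FemtoTransferGap.TT

end
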